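import Summits.Parity.GeneralizedHardyLittlewood.Theorems.GreenTaoLevelTwoMNTwoTypeIILargeSixteen
import Summits.Parity.GeneralizedHardyLittlewood.Theorems.GreenTaoLevelTwoMNTwoSixteenthFactor
import Summits.Parity.GeneralizedHardyLittlewood.Theorems.GreenTaoLevelTwoMNTwoRegroupedDenominatorPoly
import Summits.Parity.GeneralizedHardyLittlewood.Theorems.GreenTaoLevelTwoMNTwoTypeIMajorArc

/-!
# Route `GreenTaoLevelTwo`, crux `MNTwo` (stmt-Parity-21276), line `birth`, stub `stub_mnVertical`:
# Lemma 24 composed, modulo the Fourier expansion of the cutoff (GT 2008b §10)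

The whole proof of Lemma 24 (Type II sum implies major arc) composed from the landed steps for
`stub_mnVertical` (B. Green, T. Tao, *Quadratic uniformity of the Möbius function*, Ann. Inst.
Fourier 58 (2008) = arXiv:math/0606087, §10), with FIXED polynomial constants and one remaining
input: a Fourier expansion of the Bohr-gauge cutoff `ψ` on `B(n₀,3ρ)` with `J ≤ Cf·δ^{-D}` terms
(AIF Lemma 37, hypothesis `hfourN`).  Chain: `…TypeIILargeSixteen.typeII_large_sixteen` →
`Y₁₆ ≥ c₁η³²(2L+1)²(2M+1)²` (`c₁ = 1/(4096⁴3¹⁰)`) → `hfourN` at `δ = c₁η³²/2` →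
`…SixteenthFactor.sixteenth_factor_replace` → `…RegroupedDenominatorPoly.regrouped_denominator_poly`
at the level `η' = c₁^{D+1}η^{32(D+1)}/(2^{D+1}Cf)` → `q' = 2q` via
`…TypeIMajorArc.norm_nsmul_eq_distInt`.  Def-free.

* `lemma24_core` — the statement just described: the conclusion of Lemma 24 for `(s,t,L,M)` with
  `1 ≤ q' ≤ 2·10⁷⁰/η'^{416}` and `‖q'•φ''(st,st)‖ ≤ 10²⁰⁰/(η'^{1264}(2L+1)²(2M+1)²)`, under
  `10⁵⁰/η'^{544} ≤ 2L+1, 2M+1`.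

References: [GreenTao2008QuadraticMobius] arXiv:math/0606087 §10 (Lemma 24), App. A (Lemma 37).
-/

noncomputable section

open Finset
open scoped ComplexConjugate FourierTransform

namespace Summit.Parity.GeneralizedHardyLittlewood.GreenTaoLevelTwoMNTwoLemma24Core

open Literature.NumberTheory.Sieve.Vinogradov (distInt)
open Summit.Parity.GeneralizedHardyLittlewood.GreenTaoLevelTwoMNTwoTypeIILargeSixteen
  (typeII_large_sixteen)
open Summit.Parity.GeneralizedHardyLittlewood.GreenTaoLevelTwoMNTwoSixteenthFactor
  (sixteenth_factor_replace)
open Summit.Parity.GeneralizedHardyLittlewood.GreenTaoLevelTwoMNTwoRegroupedDenominatorPoly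
  (regrouped_denominator_poly)
open Summit.Parity.GeneralizedHardyLittlewood.GreenTaoLevelTwoMNTwoTypeIMajorArc
  (norm_nsmul_eq_distInt)

set_option maxHeartbeats 400000 in
/-- **Lemma 24 composed, modulo the Fourier expansion of the cutoff.**  See the module docstring;
`D, Cf` are the exponent and constant of the expansion (`J ≤ Cf δ^{-D}`, coefficients of norm
`≤ 1`), `η' = c₁^{D+1}η^{32(D+1)}/(2^{D+1}Cf)`.
[cite: GreenTao2008QuadraticMobius, §10 (proof of Lemma 24)] -/
theorem lemma24_core (k : ℕ) {N : ℕ} (α : Fin k → ℝ) (n₀ : ℤ) {ρ : ℝ} (hρ : 0 < ρ)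
    (φ : ℤ → UnitAddCircle) {D : ℕ} {Cf : ℝ} (hCf : 1 ≤ Cf) :
        (∀ n a b c : ℤ,
          (⨆ i : Fin k, ‖((((n - n₀ : ℤ) : ℝ) * α i : ℝ) : AddCircle (1 : ℝ))‖) +
              |((n - n₀ : ℤ) : ℝ)| / N < 100 * ρ →
          (⨆ i : Fin k, ‖((((n + a - n₀ : ℤ) : ℝ) * α i : ℝ) : AddCircle (1 : ℝ))‖) +
              |((n + a - n₀ : ℤ) : ℝ)| / N < 100 * ρ →
          (⨆ i : Fin k, ‖((((n + b - n₀ : ℤ) : ℝ) * α i : ℝ) : AddCircle (1 : ℝ))‖) +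
              |((n + b - n₀ : ℤ) : ℝ)| / N < 100 * ρ →
          (⨆ i : Fin k, ‖((((n + c - n₀ : ℤ) : ℝ) * α i : ℝ) : AddCircle (1 : ℝ))‖) +
              |((n + c - n₀ : ℤ) : ℝ)| / N < 100 * ρ →
          (⨆ i : Fin k, ‖((((n + a + b - n₀ : ℤ) : ℝ) * α i : ℝ) : AddCircle (1 : ℝ))‖) +
              |((n + a + b - n₀ : ℤ) : ℝ)| / N < 100 * ρ →
          (⨆ i : Fin k, ‖((((n + a + c - n₀ : ℤ) : ℝ) * α i : ℝ) : AddCircle (1 : ℝ))‖) +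
              |((n + a + c - n₀ : ℤ) : ℝ)| / N < 100 * ρ →
          (⨆ i : Fin k, ‖((((n + b + c - n₀ : ℤ) : ℝ) * α i : ℝ) : AddCircle (1 : ℝ))‖) +
              |((n + b + c - n₀ : ℤ) : ℝ)| / N < 100 * ρ →
          (⨆ i : Fin k, ‖((((n + a + b + c - n₀ : ℤ) : ℝ) * α i : ℝ) : AddCircle (1 : ℝ))‖) +
              |((n + a + b + c - n₀ : ℤ) : ℝ)| / N < 100 * ρ →
          φ (n + a + b + c) - φ (n + a + b) - φ (n + a + c) - φ (n + b + c)
            + φ (n + a) + φ (n + b) + φ (n + c) - φ n = 0) →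
    ∀ (ψ : ℤ → ℝ), (∀ n, 0 ≤ ψ n) → (∀ n, ψ n ≤ 1) →
      (∀ n, ψ n ≠ 0 →
        (⨆ i : Fin k, ‖((((n - n₀ : ℤ) : ℝ) * α i : ℝ) : AddCircle (1 : ℝ))‖) +
          |((n - n₀ : ℤ) : ℝ)| / N < ρ) →
      (∀ n, ψ n ≠ 0 → (N : ℤ) < n ∧ n ≤ 2 * N) →
      (∀ δ : ℝ, 0 < δ → δ ≤ 1 → ∃ J : ℕ, 1 ≤ J ∧ (J : ℝ) ≤ Cf / δ ^ D ∧
        ∃ (c : ℕ → ℂ) (β : ℕ → ℝ), (∀ j, ‖c j‖ ≤ 1) ∧ ∀ n : ℤ,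
          (⨆ i : Fin k, ‖((((n - n₀ : ℤ) : ℝ) * α i : ℝ) : AddCircle (1 : ℝ))‖) +
              |((n - n₀ : ℤ) : ℝ)| / N < 3 * ρ →
            ‖((ψ n : ℝ) : ℂ) - ∑ j ∈ range J, c j * (𝐞 (β j * (n : ℝ)) : ℂ)‖ ≤ δ) →
    ∀ (η : ℝ), 0 < η → η ≤ 1 →
    ∀ (K w' : ℕ), 1 ≤ K → w' ∈ Icc 1 (2 * N / K) → 2 ≤ η * ((2 * N / K : ℕ) : ℝ) →
      η * ((2 * N / K : ℕ) : ℝ) - 1 ≤ #((Icc 1 (2 * N / K)).filter fun w => w ≠ w' ∧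
        η * K ≤ ‖∑ d ∈ Ioc K (min (2 * K) (min (2 * N / w) (2 * N / w'))),
          ((ψ ((d * w : ℕ) : ℤ) : ℝ) : ℂ) * (AddCircle.toCircle (φ ((d * w : ℕ) : ℤ)) : ℂ) *
            conj (((ψ ((d * w' : ℕ) : ℤ) : ℝ) : ℂ) *
              (AddCircle.toCircle (φ ((d * w' : ℕ) : ℤ)) : ℂ))‖) →
    ∀ (s t : ℤ) (L M : ℕ), 1 ≤ L → 1 ≤ M →
      (L : ℝ) * |(s : ℝ)| ≤ (K : ℝ) / 2 → (M : ℝ) * |(t : ℝ)| ≤ ((2 * N / K : ℕ) : ℝ) / 2 →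
      (L : ℝ) * (M : ℝ) *
          ((⨆ i : Fin k, ‖((((s * t : ℤ) : ℝ) * α i : ℝ) : AddCircle (1 : ℝ))‖) +
            |((s * t : ℤ) : ℝ)| / N) ≤ ρ →
      (10 : ℝ) ^ 50 / (((1 / ((4096 : ℝ) ^ 4 * 3 ^ 10)) ^ (D + 1) * η ^ (32 * (D + 1)) / (2 ^ (D + 1) * Cf)) ^ 16) ^ 34 ≤ (((L : ℤ) - (-(L : ℤ)) + 1 : ℤ) : ℝ) →
      (10 : ℝ) ^ 50 / (((1 / ((4096 : ℝ) ^ 4 * 3 ^ 10)) ^ (D + 1) * η ^ (32 * (D + 1)) / (2 ^ (D + 1) * Cf)) ^ 16) ^ 34 ≤ (((M : ℤ) - (-(M : ℤ)) + 1 : ℤ) : ℝ) →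
    ∃ q : ℕ, 1 ≤ q ∧
      (q : ℝ) ≤ 2 * ((10 : ℝ) ^ 70 / (((1 / ((4096 : ℝ) ^ 4 * 3 ^ 10)) ^ (D + 1) * η ^ (32 * (D + 1)) / (2 ^ (D + 1) * Cf)) ^ 16) ^ 26) ∧
      ‖q • (φ (n₀ + s * t + s * t) - φ (n₀ + s * t) - φ (n₀ + s * t) + φ n₀)‖ ≤
        (10 : ℝ) ^ 200 / ((((1 / ((4096 : ℝ) ^ 4 * 3 ^ 10)) ^ (D + 1) * η ^ (32 * (D + 1)) / (2 ^ (D + 1) * Cf)) ^ 16) ^ 79 *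
          ((((L : ℤ) - (-(L : ℤ)) + 1 : ℤ) : ℝ) ^ 2 * (((M : ℤ) - (-(M : ℤ)) + 1 : ℤ) : ℝ) ^ 2)) := by
  classical
  intro hφ ψ hψ0 hψ1 hsupp hsuppN hfourN η hη hη1 K w' hK hw' hηW hgood s t L M hL hM hs ht hst
    hLbig hMbig
  -- constants
  set c₁ : ℝ := 1 / ((4096 : ℝ) ^ 4 * 3 ^ 10) with hc₁
  have hc₁pos : 0 < c₁ := by rw [hc₁]; positivity
  have hc₁1 : c₁ ≤ 1 := by rw [hc₁, div_le_one (by positivity)]; norm_num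
  set η' : ℝ := c₁ ^ (D + 1) * η ^ (32 * (D + 1)) / (2 ^ (D + 1) * Cf) with hη'
  have hCfpos : 0 < Cf := by linarith
  have hη'pos : 0 < η' := by rw [hη']; positivity
  have hη'1 : η' ≤ 1 := by
    rw [hη', div_le_one (by positivity)]
    have h1 : c₁ ^ (D + 1) ≤ 1 := pow_le_one₀ hc₁pos.le hc₁1
    have h2 : η ^ (32 * (D + 1)) ≤ 1 := pow_le_one₀ hη.le hη1
    have h3 : (1 : ℝ) ≤ 2 ^ (D + 1) := one_le_pow₀ (by norm_num)
    have h4 : c₁ ^ (D + 1) * η ^ (32 * (D + 1)) ≤ 1 * 1 :=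
      mul_le_mul h1 h2 (by positivity) zero_le_one
    nlinarith
  set nL : ℝ := (((L : ℤ) - (-(L : ℤ)) + 1 : ℤ) : ℝ) with hnLdef
  set nM : ℝ := (((M : ℤ) - (-(M : ℤ)) + 1 : ℤ) : ℝ) with hnMdef
  set nL' : ℝ := ((2 * L + 1 : ℕ) : ℝ) with hnL'
  set nM' : ℝ := ((2 * M + 1 : ℕ) : ℝ) with hnM'
  have hnL : nL = nL' := by rw [hnLdef, hnL']; push_cast; ring
  have hnM : nM = nM' := by rw [hnMdef, hnM']; push_cast; ring
  have hLr : (1 : ℝ) ≤ L := by exact_mod_cast hL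
  have hMr : (1 : ℝ) ≤ M := by exact_mod_cast hM
  have hL3 : nL' ≤ 3 * (L : ℝ) := by rw [hnL']; push_cast; linarith
  have hM3 : nM' ≤ 3 * (M : ℝ) := by rw [hnM']; push_cast; linarith
  have hnL'pos : 0 < nL' := by rw [hnL']; positivity
  have hnM'pos : 0 < nM' := by rw [hnM']; positivity
  -- step A: the sixteenfold cutoff–phase sum
  obtain ⟨d, w, l₀, m₀, θ, wt, hwt, hθ, hY⟩ := typeII_large_sixteen k α n₀ hρ φ hφ ψ hψ0 hψ1
    hsupp hsuppN η hη hη1 K w' hK hw' hηW hgood s t L M hL hM hs ht hst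
  set Y₁₆ : ℝ := ((η ^ 2 * L * M / 8) ^ 4 / ((L : ℝ) ^ 2 * (M : ℝ) ^ 2)) ^ 4 /
      (nL' ^ 3 * nM' ^ 3 * (L : ℝ) ^ 3 * (M : ℝ) ^ 3) with hY16
  have hYlow : c₁ * η ^ 32 * nL' ^ 2 * nM' ^ 2 ≤ Y₁₆ := by
    have hA : (η ^ 2 * L * M / 8) ^ 4 / ((L : ℝ) ^ 2 * (M : ℝ) ^ 2) =
        η ^ 8 * (L : ℝ) ^ 2 * (M : ℝ) ^ 2 / 4096 := by
      field_simp
      ring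
    have h5L : nL' ^ 5 ≤ (3 * (L : ℝ)) ^ 5 := pow_le_pow_left₀ hnL'pos.le hL3 5
    have h5M : nM' ^ 5 ≤ (3 * (M : ℝ)) ^ 5 := pow_le_pow_left₀ hnM'pos.le hM3 5
    have hprod : nL' ^ 5 * nM' ^ 5 ≤ (3 * (L : ℝ)) ^ 5 * (3 * (M : ℝ)) ^ 5 :=
      mul_le_mul h5L h5M (by positivity) (by positivity)
    rw [hY16, hA, le_div_iff₀ (by positivity)]
    calc c₁ * η ^ 32 * nL' ^ 2 * nM' ^ 2 * (nL' ^ 3 * nM' ^ 3 * (L : ℝ) ^ 3 * (M : ℝ) ^ 3)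
        = c₁ * η ^ 32 * (L : ℝ) ^ 3 * (M : ℝ) ^ 3 * (nL' ^ 5 * nM' ^ 5) := by ring
      _ ≤ c₁ * η ^ 32 * (L : ℝ) ^ 3 * (M : ℝ) ^ 3 * ((3 * (L : ℝ)) ^ 5 * (3 * (M : ℝ)) ^ 5) :=
          mul_le_mul_of_nonneg_left hprod (by positivity)
      _ = (η ^ 8 * (L : ℝ) ^ 2 * (M : ℝ) ^ 2 / 4096) ^ 4 := by rw [hc₁]; field_simp
  -- step B: the Fourier expansion of the cutoff at accuracy `δ = c₁η³²/2`
  set δ : ℝ := c₁ * η ^ 32 / 2 with hδ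
  have hδpos : 0 < δ := by rw [hδ]; positivity
  have hcη1 : c₁ * η ^ 32 ≤ 1 := by
    have h1 : η ^ 32 ≤ 1 := pow_le_one₀ hη.le hη1
    have h2 : c₁ * η ^ 32 ≤ c₁ := mul_le_of_le_one_right hc₁pos.le h1
    linarith
  have hδ1 : δ ≤ 1 := by
    rw [hδ]; exact (half_le_self (by positivity)).trans hcη1
  obtain ⟨J, hJ1, hJle, c, β, hc, happ⟩ := hfourN δ hδpos hδ1
  have hJpos : (0 : ℝ) < J := by exact_mod_cast hJ1
  have hJδ : (J : ℝ) * δ ^ D ≤ Cf := by rwa [le_div_iff₀ (pow_pos hδpos D)] at hJle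
  -- step C: replace the sixteenth cutoff by a character
  obtain ⟨j, -, hb⟩ := sixteenth_factor_replace α N n₀ ψ hψ0 hψ1 hsupp d w s t l₀ m₀ L M θ wt hwt
    hJ1 c (C := 1) (δ := δ) (Y := Y₁₆) (fun j _ => hc j) one_pos hδpos.le β happ hY
  -- step D: the level `η'`
  have hη'J : η' * J ≤ c₁ * η ^ 32 / 2 := by
    have hδD : δ ^ D = c₁ ^ D * η ^ (32 * D) / 2 ^ D := by
      rw [hδ, div_pow, mul_pow, ← pow_mul]
    have e1 : η' * J = (c₁ * η ^ 32 / 2) * ((J : ℝ) * δ ^ D / Cf) := by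
      rw [hδD, hη', pow_succ, pow_succ, show 32 * (D + 1) = 32 * D + 32 by ring, pow_add]
      field_simp
    have e2 : (J : ℝ) * δ ^ D / Cf ≤ 1 := by rw [div_le_one hCfpos]; exact hJδ
    rw [e1]
    have h0 : 0 ≤ c₁ * η ^ 32 / 2 := by positivity
    nlinarith
  have key : η' * nL * nL * nM * nM ≤ (Y₁₆ - δ * nL' ^ 2 * nM' ^ 2) / (J * 1) := by
    rw [mul_one, le_div_iff₀ hJpos]
    have e : η' * nL * nL * nM * nM * J = (η' * J) * (nL' ^ 2 * nM' ^ 2) := by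
      rw [hnL, hnM]; ring
    rw [e]
    calc (η' * J) * (nL' ^ 2 * nM' ^ 2) ≤ (c₁ * η ^ 32 / 2) * (nL' ^ 2 * nM' ^ 2) :=
          mul_le_mul_of_nonneg_right hη'J (by positivity)
      _ = c₁ * η ^ 32 * nL' ^ 2 * nM' ^ 2 - δ * nL' ^ 2 * nM' ^ 2 := by rw [hδ]; ring
      _ ≤ Y₁₆ - δ * nL' ^ 2 * nM' ^ 2 := by linarith
  -- step E: regrouping and the denominator
  have hwt1 : ∀ l m, |wt l m| ≤ 1 := by
    intro l m
    rw [hwt]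
    split_ifs
    · rw [abs_of_nonneg (hψ0 _)]; exact hψ1 _
    · simp
  have hχ : ∀ (P : Prop) [Decidable P], |(if P then (1 : ℝ) else 0)| ≤ 1 := by
    intro P _; split_ifs <;> simp
  obtain ⟨q, hq1, hqQ, hqd⟩ := regrouped_denominator_poly wt hwt1
    (fun l₁ l₂ => if l₀ + l₂ + l₁ ∈ Icc (1 : ℤ) L then (1 : ℝ) else 0)
    (fun m₁ m₂ => if m₀ + m₂ + m₁ ∈ Icc (1 : ℤ) M then (1 : ℝ) else 0)
    (fun _ _ => hχ _) (fun _ _ => hχ _) (β j) θ d w s t l₀ m₀ hη'pos hη'1 hLbig hMbig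
    (key.trans hb)
  -- step F: `q' = 2q`
  refine ⟨2 * q, by omega, ?_, ?_⟩
  · rw [Nat.cast_mul, Nat.cast_two]; linarith [hqQ]
  · rw [← hθ, norm_nsmul_eq_distInt]
    have e : (((2 * q : ℕ)) : ℝ) * θ = (q : ℝ) * (2 * θ) := by push_cast; ring
    rw [e]
    rw [← hnLdef, ← hnMdef] at hqd
    exact hqd

end Summit.Parity.GeneralizedHardyLittlewood.GreenTaoLevelTwoMNTwoLemma24Core
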